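import Mathlib
import Literature.MathematicalPhysics.QuantumFieldTheory.Balaban1983to89.B14DomainGeom
import Literature.MathematicalPhysics.QuantumFieldTheory.Balaban1983to89.B16Sect1Kernels

/-!
# `Balaban1983to89.B16Incl176Layers` — [Balaban1989LargeFieldII] (1.76) p. 381 «Z_j ⊂ Z′^{~10}_{j−1} ∪ ⋃_i (Z_j^{(i)})^{~2}»
against the [III] §3 construction of the next large-field region ((3.2)–(3.5) p. 264–265, (3.20) p. 269 of
[Balaban1988Convergent]): the LAYER COUNT, kernel-checked on the cell's cube-layer carrier `…B14DomainGeom`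

T. Bałaban, *Large field renormalization. II. Localization, exponentiation, and bounds for the 𝐑 operation*, Commun.
Math. Phys. **122** (1989) 355–392 [Balaban1989LargeFieldII] (cell paper B16; PDF held
`paper:balaban1989-cmp122-large-field-ii`, journal page = PDF page + 354; p. 380–381, 384–386 = PDF 26–27, 30–32,
RE-READ AS IMAGES by this seat on the x2 renders `run/shared/lean/pub/pub-balaban/b2b-balaban-ref1/pages/1989-cmp122-large-field-II/…-p026/p027/p030/p031/p032-x2.png`);
T. Bałaban, *Convergent renormalization expansions for lattice gauge theories*, Commun. Math. Phys. **119** (1988)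
243–285 [Balaban1988Convergent] (cell paper B14 = «[III]»; PDF held `paper:balaban1988-cmp119-convergent-renormalization`,
journal page = PDF page + 242; pp. 264–265, 269 = PDF 22–23, 27, re-read as images on
`…/1988-cmp119-convergent-renormalization/…-p022/p023/p027-x2.png`); T. Bałaban, *Large field renormalization. I*,
Commun. Math. Phys. **122** (1989) 175–202 [Balaban1989LargeFieldI] (= «[IV]», cell paper B15; p. 177, (1.10) p. 179).

statement-level skeleton of published theorems with citation tags; proofs where landed; nothing here is a claim about
the Yang–Mills mass gap

CITATION HEADER / WHAT IS REPRODUCED.  Mega-formalization `lit-balaban`, HOME `run/shared/lean/pub/lit-balaban/`;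
reader/typer **r13 gen 15** (B16 display-level owner; rows `lit-balaban-r13/ROWS-B16.md` v2.51).  SKELETON row
**B16.Eq1.76** (owner r13; typed gen 1 as the quoted leaf `B16Sect1Kernels.Incl176 enl10 enl2 Zprev Znew Zj :=
Zj ⊆ enl10 Zprev ∪ ⋃ i, enl2 (Znew i)`, p238958 — print states (1.76) WITHOUT ARGUMENT: *«The above large field domain
has also the following important property»*; the owner's survey classed it «definitional from the [III] §3 / [IV] §1
construction of Z_j — cross-block»).  This module carries out exactly that cross-block derivation on the cube-layer
carrier of the cell module `…B14DomainGeom` (unit b2b-balaban-pv02; points `Pt d = ℤᵈ`, `enl s n X = X̃ⁿ` for the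
side-`s` cubes, `enl_union`, `enl_enl`), with [III]'s construction transcribed by the SAME conventions that module uses
for its `omega35_subset_compl_enl` (*«(3.5) forces Ω_{k+1} ⊆ (Z_k′^{∼8})ᶜ»*) and `lambda320_subset_innerN`; rows
B14.Eq3.5 / B14.Eq3.20 (owner r11) are the inputs and are NOT re-typed — their printed equations enter as hypotheses
`hB`, `hΩ`, `hΛ` (G.5-45 (ii)).  Also touched: row B16.Txt@385 (the p. 385 class conversion uses `(Z₁^{(i)})^{~3}`,
one layer more than (1.76)) — arithmetic member under the alternative layer count, §5.

THE PRINT.  B16 p. 380 [PDF 26] foot: *«Take the cover of the large field region P_j ∪ Q_j ∪ R_j by MR_j-cubes, i.e.,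
the smallest domain containing this region, which is a union of MR_j-cubes. This domain is a union of components denoted
by Z_j^{(i)}, hence it is equal to ⋃_i Z_j^{(i)}.»*  p. 381 [PDF 27]: *«The above large field domain has also the following
important property:  Z_j ⊂ Z′^{~10}_{j−1} ∪ ⋃_i (Z_j^{(i)})^{~2}.  (1.76)»*  p. 384 [PDF 30]: *«If Z is a union of
MR_j-cubes of the lattice T_ξ, ξ = L^{−j}, then we take the cover Z′ of Z by a smallest union of LMR_{j+1}-cubes, and we
add ten layers of such cubes. We denote the obtained domain by S(Z), i.e., S(Z) = Z′^{~10}. Such a domain arises as a new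
large field region in our procedure, if no large fields are created in a neighborhood of Z»*.  [IV] p. 177 [PDF 3]:
*«Each renormalization step adds at least ten layers of MR_k-cubes»*.  [III] p. 264 [PDF 22]: *«The term has a large
field region Z_k = Λ_k^c, and we denote by Z_k′ the union of all LMR_{k+1}-cubes intersecting the region Z_k … We
surround Z_k′ by four layers of the LMR_{k+1}-cubes, i.e., we take the domain Z_k′^{~4}»*; p. 265 [PDF 23]: *«where the
summation is over domains P_{k+1} ⊂ (Z_k′^{~4})ᶜ … We take the set P′_{k+1} – the union of all LMR_{k+1}-cubes
intersecting P_{k+1} – and we surround the union P′_{k+1} ∪ Z_k′^{~4} by a layer of LMR_{k+1}-cubes. … Denote by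
P¹_{k+1} the subset of T^{(k+1)} such that B^{k+1}(P¹_{k+1}) = (P′^~_{k+1})ᶜ ∩ (Z_k′^{~5})ᶜ. … We denote again by Q′_{k+1}
the union of LMR_{k+1}-cubes intersecting Q_{k+1}, and we surround the domain Q′_{k+1} ∪ ((B^{k+1}(P¹_{k+1}))ᶜ)^~ by two
layers of such cubes. Denote  Ω_{k+1} = (Q′^{~2}_{k+1} ∪ (B^{k+1}(P¹_{k+1})ᶜ)^{~3})ᶜ,  (3.5)»*; p. 269 [PDF 27]: *«The domain
R′_{k+1} is defined, as usual, as a union of the LMR_{k+1}-cubes intersecting R_{k+1}. We surround the domain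
(Ω^c_{k+1})^~ ∪ R′_{k+1} by a layer of LMR_{k+1}-cubes, and we denote the complement of the so-obtained domain by
Λ_{k+1}, hence  Λ_{k+1} = ((Ω^c_{k+1})^{~2} ∪ R′^~_{k+1})ᶜ = Ω^{~−2}_{k+1} ∩ (R′^~_{k+1})ᶜ  (3.20)»*; [III] (2.3) p. 255:
*«Z_j = Λ_j^c»*.  The three large-field characteristic functions of the j-th step named on B16 p. 380 —
*«χ^c_j(P_j) … χ′^c_j(Q_j) … χ^{(j−1)c}(R_j)»* — are those of [III] (3.2), (3.3), (3.16) (j = k + 1).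

WHAT THIS FILE PROVES (kernel-checked set algebra; zero `sorry`; NO new definition, NO new `def … : Prop` fact;
axioms standard).  With `Z' := enl s 0 Z` (the `LMR_{k+1}`-cover of `Z = Z_k`) and the three printed equations as
hypotheses — `hB : B = (enl s 1 P')ᶜ ∩ (enl s 5 Z')ᶜ` (p. 265), `hΩ : Ω = (enl s 2 Q' ∪ enl s 3 Bᶜ)ᶜ` ((3.5)),
`hΛ : Λ₁ = (enl s 2 Ωᶜ ∪ enl s 1 R')ᶜ` ((3.20)) — for ANY sets `P', Q', R'` (in print: the `LMR_{k+1}`-covers `P′, Q′, R′`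
of `P_{k+1}, Q_{k+1}, R_{k+1}`; the raw regions give the same sets, since `enl s n X = enl s n (enl s 0 X)`):
§1 **`largeField_next_eq`** — the next large-field region COMPUTED:
   `Λ₁ᶜ = enl s 10 Z' ∪ enl s 6 P' ∪ enl s 4 Q' ∪ enl s 1 R'`, i.e. Z_{k+1} = Z_k′^{~10} ∪ P′^{~6} ∪ Q′^{~4} ∪ R′^{~1}
   (exact set identity; layer bookkeeping 4 → 5 → (·)^{~3} 8 → (·)^{~2} 10 for Z_k′ — which IS B16's S(Z) = Z′^{~10} of
   p. 384 and [IV] p. 177's «ten layers», and agrees with `B14DomainGeom.omega35_subset_compl_enl`'s eight layers at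
   Ω_{k+1} and with [IV] (1.10) «Z″_k = (Z′_{k−N₀})^{~3} = (Ω^{~5}_{k−N₀+1})ᶜ ∩ Z»: 8 − 5 = 3 — a cross-check of the
   transcription; the new covers collect 1 → 4 → 6 (P′), 2 → 4 (Q′), 1 (R′)).
§2 **`incl176_six`** / **`incl176_six_components`** — consequently the (1.76)-SHAPED inclusion holds with SIX layers
   around the new large-field covers: `Λ₁ᶜ ⊆ enl s 10 Z' ∪ enl s 6 (P' ∪ Q' ∪ R')`, and, for every family `Znew` covering
   `P' ∪ Q' ∪ R'` (p. 380: the components `Z_j^{(i)}` of that cover), the ROW'S OWN DECL in the instance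
   `B16Sect1Kernels.Incl176 (enl s 10) (enl s 6) Z' Znew Λ₁ᶜ` — INHABITED.
§3 **`printed_two_layers_fail`** / **`six_layers_sharp`** — in this transcription the PRINTED instance `Incl176 (enl s 10)
   (enl s 2) …` is NOT a consequence of the construction: one isolated `P′`-cube (side `s = 1`, `Z = Q′ = R′ = ∅`,
   `P′ = {0}`, any dimension ≥ 1) puts the point `(6,…,6)` into `Λ₁ᶜ` (sixth layer of `P′`) but outside
   `Z′^{~10} ∪ P′^{~2}`; and no layer count below six works (`(6,…,6) ∉ P′^{~5}`).
§4 **`firstStep_largeField_eq`** — the same bookkeeping for the FIRST step, [III] (1.10) p. 248 / (1.20) p. 251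
   (`Ω₁ = (Q₁′^{~2} ∪ (B(P₁¹)ᶜ)^{~3})ᶜ`, `Λ₁ = ((Ω₁ᶜ)^{~2} ∪ R₁′^~)ᶜ`, typed by the cell as `B14Sect1Sets.Omega1` /
   `B14DomainGeom.lambda320_*`): `Z₁ = Λ₁ᶜ = enl s 4 Q₁' ∪ enl s 5 B₁ᶜ ∪ enl s 1 R₁'` — B16 p. 385's base case *«Z ⊂ ⋃_i
   (Z₁^{(i)})^{~2}»* meets the same count (≥ 4 layers at `Q₁′`).
§5 **`enlarge_arith_seven`** — the ARITHMETIC member of the p. 385 class conversion under the alternative count: p. 385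
   converts through `(Z₁^{(i)})^{~3}` = one layer more than (1.76)'s `~2` (*«Z ⊂ ⋃_i (Z₁^{(i)})^{~2}. Then d′₁(Z) ≦ Σ_i
   d′₁((Z₁^{(i)})^{~3}), and d′₁((Z₁^{(i)})^{~3}) ≦ 7^d(3·2^{d−1}d′₁(Z₁^{(i)}) + 2^d) ≦ 2(14)^d(d′₁(Z₁^{(i)}) + ½)»*,
   `7^d` = cubes of `□^{~3}`); with six layers the conversion runs through `(·)^{~7}`, `15^d` cubes of `□^{~7}`, and
   `15^d(3·2^{d−1}x + 2^d) ≦ 2·30^d(x + ½)` (`1 ≦ d`, `0 ≦ x`) — the r13 gen-11 lemma `B16Ineq182Gluing.enlarge_arith`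
   with 7/14 replaced by 15/30; so the p. 385 display, (1.82)'s `¼γ₀(14)^{−d}` and the condition *«¼γ₀(14)^{−d}A₁²p₀²(g₁)
   ≧ O(1)2(64)^dM^dL^{d+1}R₁^{d+2} … satisfied for p₀ large, and g₁ sufficiently small»* change by `14 ↦ 30` ONLY —
   CONSTANTS, no new clause type (the cell's adjudication C-b01g15-3 A1 of DIVERGENCE D-b01g15.1, «any linear count …
   closes p. 385 with adjusted numerics», applies verbatim).

HONEST SCOPE / READING (declared; nothing printed is asserted or used as a fact).  (a) The three equations `hB`, `hΩ`,
`hΛ` are [III]'s displayed constructions read, as in `…B14DomainGeom` (pv02, ACCEPTED, second-read in the cell), with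
ALL `~` = one layer of `LMR_{k+1}`-cubes of ONE partition (side `s`), `X′ = enl s 0 X`, `X′^~ = enl s 1 X` for the raw
regions (`enl s 1 X = enl s 1 (enl s 0 X)` by `enl_enl`), blocks `B^{k+1}(·)` identified with their regions, and
`Z_{k+1} := Λ_{k+1}ᶜ` BEFORE [III]'s p. 269 box modification (*«if a component is contained in a cube of the size
100LMR_{k+1}, then we replace it by the smallest rectangular parallelepiped containing it»* — which can only ENLARGE
`Λ_{k+1}ᶜ`, so it does not rescue a two-layer inclusion).  (b) `P′, Q′, R′ ⊆ ⋃_i Z_j^{(i)}` is p. 380's definition of the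
`Z_j^{(i)}` (components of the cover of `P_j ∪ Q_j ∪ R_j`); `hcov` is that sentence.  (c) CONCLUSION OF THE READING, for
the owner's ledger and the lead's §5 ERRATA register, NOT a claim about the paper's mathematics: under (a)–(b) the
printed «~2» of (1.76) (and of (1.84) p. 386, its one-step-later twin) is not implied by [III] (3.2)–(3.5)/(3.20), while
«~6» is, exactly; EITHER (1.76)'s «2» is a slip for «6» (constants-only downstream, §5), OR B16's `Z_j^{(i)}` denotes a
larger cover than p. 380's sentence says (e.g. the components of `P′^{~4} ∪ Q′^{~2} ∪ R′` would give exactly two)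
— print does not say; the b2b cell's `B16MergeGeometry` consumes (1.76)/(1.84) only as `Z ⊆ X ∪ Y` over
abstract envelope domains, so nothing in the tree depends on the count.  Row B16.Eq1.76's head stays at the lead's
call (`typed` leaf as printed; six-layer instance inhabited here).  Owners r11 (B14 (3.5)/(3.20)) and r12 (B15 (1.10),
p. 177) are asked in HOME/INBOX to confirm or veto the layer arithmetic; second reader r16.
-/

namespace Literature.MathematicalPhysics.QuantumFieldTheory.Balaban1983to89.B16Incl176Layers

open Literature.MathematicalPhysics.QuantumFieldTheory.Balaban1983to89
open B14DomainGeom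

variable {d : ℕ}

/-! ## §0 Layer lemmas (folklore, over `…B14DomainGeom`) -/

/-- `~ⁿ` distributes over arbitrary unions. [folklore] -/
private theorem enl_iUnion {ι : Type*} (s n : ℕ) (X : ι → Set (Pt d)) :
    enl s n (⋃ i, X i) = ⋃ i, enl s n (X i) := by
  ext x
  simp only [enl, Set.mem_setOf_eq, Set.mem_iUnion]
  constructor
  · rintro ⟨y, ⟨i, hy⟩, hn⟩
    exact ⟨i, y, hy, hn⟩
  · rintro ⟨i, y, hy, hn⟩
    exact ⟨y, ⟨i, hy⟩, hn⟩

/-- `∅^{~n} = ∅`. [folklore] -/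
private theorem enl_empty (s n : ℕ) : enl s n (∅ : Set (Pt d)) = ∅ := by
  ext x
  simp [enl]

/-- Layer composition with the numerals used below: `(X^{~a})^{~b} = X^{~(a+b)}`. [folklore] -/
private theorem enl_enl_num (s a b c : ℕ) (hs : 0 < s) (h : a + b = c) (X : Set (Pt d)) :
    enl s b (enl s a X) = enl s c X := by
  rw [enl_enl s a b hs, h]

/-- With side `s = 1` the cube index is the point itself. [folklore] -/
private theorem cubeIdx_one (x : Pt d) : cubeIdx 1 x = x := by
  funext i
  simp [cubeIdx]

/-! ## §1 The next large-field region computed from [III] (3.2)–(3.5), (3.20) -/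

/-- **Z_{k+1} = Z_k′^{~10} ∪ P′^{~6}_{k+1} ∪ Q′^{~4}_{k+1} ∪ R′^{~1}_{k+1}.**  With `Z' = enl s 0 Z` (the `LMR_{k+1}`-cover
of `Z_k`), `B = B^{k+1}(P¹_{k+1}) = (P′^~)ᶜ ∩ (Z′^{~5})ᶜ` (p. 265), `Ω = Ω_{k+1} = (Q′^{~2} ∪ (Bᶜ)^{~3})ᶜ` ((3.5)) and
`Λ₁ = Λ_{k+1} = ((Ωᶜ)^{~2} ∪ R′^~)ᶜ` ((3.20)), the large-field region `Z_{k+1} = Λ_{k+1}ᶜ` ((2.3)) is EXACTLY the union of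
ten layers around `Z_k′`, six around `P′`, four around `Q′`, one around `R′` — the `Z_k′^{~10}` member is B16 p. 384's
`S(Z) = Z′^{~10}` and [IV] p. 177's «ten layers».  PROVED (set algebra on `…B14DomainGeom`'s carrier). [cite:
Balaban1988Convergent, (3.5) p.265, (3.20) p.269, p.264–265 (Z_k′, Z_k′^{~4}, P′, B^{k+1}(P¹_{k+1}) = (P′^~)ᶜ ∩ (Z_k′^{~5})ᶜ,
Q′), (2.3) p.255 (Z_j = Λ_j^c); Balaban1989LargeFieldII, p.384 (S(Z) = Z′^{~10})] -/
theorem largeField_next_eq (s : ℕ) (hs : 0 < s) (Z P' Q' R' B Ω Λ₁ : Set (Pt d))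
    (hB : B = (enl s 1 P')ᶜ ∩ (enl s 5 (enl s 0 Z))ᶜ)
    (hΩ : Ω = (enl s 2 Q' ∪ enl s 3 Bᶜ)ᶜ)
    (hΛ : Λ₁ = (enl s 2 Ωᶜ ∪ enl s 1 R')ᶜ) :
    Λ₁ᶜ = enl s 10 (enl s 0 Z) ∪ enl s 6 P' ∪ enl s 4 Q' ∪ enl s 1 R' := by
  have hBc : Bᶜ = enl s 1 P' ∪ enl s 5 (enl s 0 Z) := by
    rw [hB, Set.compl_inter, compl_compl, compl_compl]
  have hΩc : Ωᶜ = enl s 2 Q' ∪ (enl s 4 P' ∪ enl s 8 (enl s 0 Z)) := by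
    rw [hΩ, compl_compl, hBc, enl_union, enl_enl_num s 1 3 4 hs rfl, enl_enl_num s 5 3 8 hs rfl]
  have hΛc : Λ₁ᶜ = enl s 2 Ωᶜ ∪ enl s 1 R' := by
    rw [hΛ, compl_compl]
  rw [hΛc, hΩc, enl_union, enl_union, enl_enl_num s 2 2 4 hs rfl, enl_enl_num s 4 2 6 hs rfl,
    enl_enl_num s 8 2 10 hs rfl]
  ext x
  simp only [Set.mem_union]
  tauto

/-- The four members separately: `Z_k′^{~10} ⊆ Z_{k+1}` (B16 p. 384: *«Such a domain arises as a new large field region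
in our procedure»*), `P′^{~6} ⊆ Z_{k+1}`, `Q′^{~4} ⊆ Z_{k+1}`, `R′^{~1} ⊆ Z_{k+1}`. [cite: Balaban1988Convergent, (3.5)
p.265, (3.20) p.269; Balaban1989LargeFieldII, p.384 (S(Z) = Z′^{~10})] -/
theorem layers_subset_largeField_next (s : ℕ) (hs : 0 < s) (Z P' Q' R' B Ω Λ₁ : Set (Pt d))
    (hB : B = (enl s 1 P')ᶜ ∩ (enl s 5 (enl s 0 Z))ᶜ)
    (hΩ : Ω = (enl s 2 Q' ∪ enl s 3 Bᶜ)ᶜ)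
    (hΛ : Λ₁ = (enl s 2 Ωᶜ ∪ enl s 1 R')ᶜ) :
    enl s 10 (enl s 0 Z) ⊆ Λ₁ᶜ ∧ enl s 6 P' ⊆ Λ₁ᶜ ∧ enl s 4 Q' ⊆ Λ₁ᶜ ∧ enl s 1 R' ⊆ Λ₁ᶜ := by
  rw [largeField_next_eq s hs Z P' Q' R' B Ω Λ₁ hB hΩ hΛ]
  refine ⟨?_, ?_, ?_, ?_⟩ <;> intro x hx <;> simp only [Set.mem_union] <;> tauto

/-! ## §2 (1.76) with SIX layers around the new large-field covers -/

/-- **(1.76)-shaped inclusion, six layers.**  `Z_{k+1} ⊆ Z_k′^{~10} ∪ (P′ ∪ Q′ ∪ R′)^{~6}` from the construction of §1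
(`Q′^{~4} ⊆ Q′^{~6}`, `R′^{~1} ⊆ R′^{~6}`). [cite: Balaban1989LargeFieldII, (1.76) p.381 (shape; with `~6` in place of
the printed `~2`); Balaban1988Convergent, (3.5) p.265, (3.20) p.269] -/
theorem incl176_six (s : ℕ) (hs : 0 < s) (Z P' Q' R' B Ω Λ₁ : Set (Pt d))
    (hB : B = (enl s 1 P')ᶜ ∩ (enl s 5 (enl s 0 Z))ᶜ)
    (hΩ : Ω = (enl s 2 Q' ∪ enl s 3 Bᶜ)ᶜ)
    (hΛ : Λ₁ = (enl s 2 Ωᶜ ∪ enl s 1 R')ᶜ) :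
    Λ₁ᶜ ⊆ enl s 10 (enl s 0 Z) ∪ enl s 6 (P' ∪ Q' ∪ R') := by
  rw [largeField_next_eq s hs Z P' Q' R' B Ω Λ₁ hB hΩ hΛ]
  have hP : P' ⊆ P' ∪ Q' ∪ R' := fun x hx => Or.inl (Or.inl hx)
  have hQ : Q' ⊆ P' ∪ Q' ∪ R' := fun x hx => Or.inl (Or.inr hx)
  have hR : R' ⊆ P' ∪ Q' ∪ R' := fun x hx => Or.inr hx
  rintro x (((h10 | h6) | h4) | h1)
  · exact Or.inl h10
  · exact Or.inr (enl_mono s 6 hP h6)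
  · exact Or.inr (enl_mono s 6 hQ (enl_mono_layers s (by norm_num : 4 ≤ 6) Q' h4))
  · exact Or.inr (enl_mono s 6 hR (enl_mono_layers s (by norm_num : 1 ≤ 6) R' h1))

/-- **Row B16.Eq1.76's decl INHABITED in the six-layer instance.**  For every family `Znew` of regions covering
`P′ ∪ Q′ ∪ R′` — p. 380: *«the cover of the large field region P_j ∪ Q_j ∪ R_j by MR_j-cubes … is a union of components
denoted by Z_j^{(i)}, hence it is equal to ⋃_i Z_j^{(i)}»* (`hcov`) — the typed (1.76)
`B16Sect1Kernels.Incl176 enl10 enl2 Zprev Znew Zj` holds with `enl10 = enl s 10`, the SIX-layer map `enl s 6` in the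
`~2` slot, `Zprev = Z_k′`, `Zj = Z_{k+1}`. [cite: Balaban1989LargeFieldII, (1.76) p.381, p.380 (Z_j^{(i)});
Balaban1988Convergent, (3.5) p.265, (3.20) p.269] -/
theorem incl176_six_components {ι : Type*} (s : ℕ) (hs : 0 < s) (Z P' Q' R' B Ω Λ₁ : Set (Pt d))
    (Znew : ι → Set (Pt d)) (hcov : P' ∪ Q' ∪ R' ⊆ ⋃ i, Znew i)
    (hB : B = (enl s 1 P')ᶜ ∩ (enl s 5 (enl s 0 Z))ᶜ)
    (hΩ : Ω = (enl s 2 Q' ∪ enl s 3 Bᶜ)ᶜ)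
    (hΛ : Λ₁ = (enl s 2 Ωᶜ ∪ enl s 1 R')ᶜ) :
    B16Sect1Kernels.Incl176 (enl s 10) (enl s 6) (enl s 0 Z) Znew Λ₁ᶜ := by
  intro x hx
  rcases incl176_six s hs Z P' Q' R' B Ω Λ₁ hB hΩ hΛ hx with h | h
  · exact Or.inl h
  · right
    have h' : x ∈ enl s 6 (⋃ i, Znew i) := enl_mono s 6 hcov h
    rwa [enl_iUnion] at h'

/-! ## §3 The printed two-layer instance is not a consequence of the construction (this transcription) -/

/-- **Counterexample to the printed count.**  In every dimension `d + 1 ≥ 1`, with side `s = 1`, no previous region and no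
`Q`/`R` regions (`Z = Q′ = R′ = ∅`) and ONE new `P′`-cube `P′ = {0}`, the construction (3.2)–(3.5)/(3.20) yields a
large-field region `Z_{k+1} = P′^{~6} ∋ (6,…,6)`, a point outside `Z′^{~10} ∪ P′^{~2} = P′^{~2}`: the instance
`Incl176 (enl 1 10) (enl 1 2) Z′ (fun _ => P′ ∪ Q′ ∪ R′) Z_{k+1}` — (1.76) with its PRINTED `~2` and the single
component `Z^{(1)} = P′` — FAILS.  (Index model; a READING of print, see the module docstring (c).) [cite:
Balaban1989LargeFieldII, (1.76) p.381 (printed `~2`); Balaban1988Convergent, (3.5) p.265, (3.20) p.269] -/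
theorem printed_two_layers_fail (d : ℕ) :
    ∃ Z P' Q' R' B Ω Λ₁ : Set (Pt (d + 1)),
      B = (enl 1 1 P')ᶜ ∩ (enl 1 5 (enl 1 0 Z))ᶜ ∧ Ω = (enl 1 2 Q' ∪ enl 1 3 Bᶜ)ᶜ ∧
      Λ₁ = (enl 1 2 Ωᶜ ∪ enl 1 1 R')ᶜ ∧
      ¬ B16Sect1Kernels.Incl176 (enl 1 10) (enl 1 2) (enl 1 0 Z) (fun _ : Unit => P' ∪ Q' ∪ R') Λ₁ᶜ := by
  set P' : Set (Pt (d + 1)) := {fun _ => 0} with hP'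
  refine ⟨∅, P', ∅, ∅, (enl 1 1 P')ᶜ ∩ (enl 1 5 (enl 1 0 ∅))ᶜ, _, _, rfl, rfl, rfl, ?_⟩
  intro h
  -- the point (6,…,6)
  set x6 : Pt (d + 1) := fun _ => 6 with hx6
  have hmem : x6 ∈ ((enl 1 2 (enl 1 2 (∅ : Set (Pt (d + 1))) ∪
      enl 1 3 ((enl 1 1 P')ᶜ ∩ (enl 1 5 (enl 1 0 ∅))ᶜ)ᶜ)ᶜᶜ ∪ enl 1 1 ∅)ᶜ)ᶜ := by
    rw [largeField_next_eq 1 Nat.one_pos ∅ P' ∅ ∅ _ _ _ rfl rfl rfl]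
    refine Or.inl (Or.inl (Or.inr ⟨fun _ => 0, by simp [hP'], fun i => ?_⟩))
    simp [cubeIdx_one, hx6]
  rcases h hmem with h10 | h2
  · rw [enl_empty, enl_empty] at h10
    exact h10
  · simp only [Set.union_empty, Set.mem_iUnion] at h2
    obtain ⟨-, y, hy, hn⟩ := h2
    have hy0 : y = fun _ => 0 := by simpa [hP'] using hy
    have := hn 0
    rw [cubeIdx_one, cubeIdx_one, hy0, hx6] at this
    norm_num at this

/-- **Six is sharp.**  Same configuration: `(6,…,6) ∈ Z_{k+1}` lies outside `Z′^{~10} ∪ (P′ ∪ Q′ ∪ R′)^{~5}` — no count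
below six layers around the new covers is implied by the construction. [cite: Balaban1988Convergent, (3.5) p.265, (3.20)
p.269; Balaban1989LargeFieldII, (1.76) p.381] -/
theorem six_layers_sharp (d : ℕ) :
    ∃ Z P' Q' R' B Ω Λ₁ : Set (Pt (d + 1)),
      B = (enl 1 1 P')ᶜ ∩ (enl 1 5 (enl 1 0 Z))ᶜ ∧ Ω = (enl 1 2 Q' ∪ enl 1 3 Bᶜ)ᶜ ∧
      Λ₁ = (enl 1 2 Ωᶜ ∪ enl 1 1 R')ᶜ ∧
      ¬ (Λ₁ᶜ ⊆ enl 1 10 (enl 1 0 Z) ∪ enl 1 5 (P' ∪ Q' ∪ R')) := by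
  set P' : Set (Pt (d + 1)) := {fun _ => 0} with hP'
  refine ⟨∅, P', ∅, ∅, (enl 1 1 P')ᶜ ∩ (enl 1 5 (enl 1 0 ∅))ᶜ, _, _, rfl, rfl, rfl, ?_⟩
  intro h
  set x6 : Pt (d + 1) := fun _ => 6 with hx6
  have hmem : x6 ∈ ((enl 1 2 (enl 1 2 (∅ : Set (Pt (d + 1))) ∪
      enl 1 3 ((enl 1 1 P')ᶜ ∩ (enl 1 5 (enl 1 0 ∅))ᶜ)ᶜ)ᶜᶜ ∪ enl 1 1 ∅)ᶜ)ᶜ := by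
    rw [largeField_next_eq 1 Nat.one_pos ∅ P' ∅ ∅ _ _ _ rfl rfl rfl]
    refine Or.inl (Or.inl (Or.inr ⟨fun _ => 0, by simp [hP'], fun i => ?_⟩))
    simp [cubeIdx_one, hx6]
  rcases h hmem with h10 | h5
  · rw [enl_empty, enl_empty] at h10
    exact h10
  · simp only [Set.union_empty] at h5
    obtain ⟨y, hy, hn⟩ := h5
    have hy0 : y = fun _ => 0 := by simpa [hP'] using hy
    have := hn 0
    rw [cubeIdx_one, cubeIdx_one, hy0, hx6] at this
    norm_num at this

/-! ## §4 The first step ([III] (1.10) p. 248, (1.20) p. 251): the same count behind B16 p. 385's base case -/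

/-- **First step.**  With `Ω₁ = (Q₁′^{~2} ∪ (B(P₁¹)ᶜ)^{~3})ᶜ` ((1.10) p. 248; the cell's `B14Sect1Sets.Omega1`) and
`Λ₁ = ((Ω₁ᶜ)^{~2} ∪ R₁′^~)ᶜ` ((1.20) p. 251), the first large-field region is `Z₁ = Λ₁ᶜ = Q₁′^{~4} ∪ (B(P₁¹)ᶜ)^{~5} ∪
R₁′^{~1}` — so the `Q₁`-covers carry four layers in `Z₁`, against B16 p. 385's *«Z ⊂ ⋃_i (Z₁^{(i)})^{~2}»*; the layers of
the `P`-covers inside `B(P₁¹)ᶜ` depend on the reading of [III]'s printed `P₁¹` (cell GAPS G-adv5-6, `B14Sect1Sets`) and are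
not fixed here. [cite: Balaban1988Convergent, (1.10) p.248, (1.20) p.251; Balaban1989LargeFieldII, p.385 (base case
j = 1 of (1.80), «Z ⊂ ⋃_i (Z₁^{(i)})^{~2}»)] -/
theorem firstStep_largeField_eq (s : ℕ) (hs : 0 < s) (Q₁' R₁' B₁ Ω₁ Λ₁ : Set (Pt d))
    (hΩ : Ω₁ = (enl s 2 Q₁' ∪ enl s 3 B₁ᶜ)ᶜ) (hΛ : Λ₁ = (enl s 2 Ω₁ᶜ ∪ enl s 1 R₁')ᶜ) :
    Λ₁ᶜ = enl s 4 Q₁' ∪ enl s 5 B₁ᶜ ∪ enl s 1 R₁' ∧ enl s 4 Q₁' ⊆ Λ₁ᶜ := by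
  have h : Λ₁ᶜ = enl s 4 Q₁' ∪ enl s 5 B₁ᶜ ∪ enl s 1 R₁' := by
    rw [hΛ, compl_compl, hΩ, compl_compl, enl_union, enl_enl_num s 2 2 4 hs rfl, enl_enl_num s 3 2 5 hs rfl]
  exact ⟨h, by rw [h]; exact fun x hx => Or.inl (Or.inl hx)⟩

/-! ## §5 p. 385 / (1.82) under the six-layer count: the arithmetic member with 15/30 for 7/14 -/

/-- **The class-conversion arithmetic with seven layers.**  p. 385 converts sizes through `(Z₁^{(i)})^{~3}` (one layer more
than (1.76)'s `~2`; `7^d` = the cubes of `□^{~3}`): *«d′₁((Z₁^{(i)})^{~3}) ≦ 7^d(3·2^{d−1}d′₁(Z₁^{(i)}) + 2^d) ≦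
2(14)^d(d′₁(Z₁^{(i)}) + ½)»*.  Under the six-layer count of §1 the conversion runs through `(·)^{~7}` (`15^d` cubes of
`□^{~7}`) and the same arithmetic gives `15^d(3·2^{d−1}x + 2^d) ≦ 2·30^d(x + ½)` (`1 ≦ d`, `0 ≦ x`; false at `d = 0` where
Lean's `2^(0−1) = 1`, as for the printed member — r13 gen 11 `B16Ineq182Gluing.enlarge_arith`): the printed `2(14)^d` and
(1.82)'s `¼γ₀(14)^{−d}` become `2(30)^d`, `¼γ₀(30)^{−d}` — constants only. PROVED. [cite: Balaban1989LargeFieldII, p.385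
(display after (1.81)), (1.82) p.385] -/
theorem enlarge_arith_seven {d : ℕ} (hd : 1 ≤ d) {x : ℝ} (hx : 0 ≤ x) :
    (15 : ℝ) ^ d * (3 * 2 ^ (d - 1) * x + 2 ^ d) ≤ 2 * 30 ^ d * (x + 1 / 2) := by
  obtain ⟨e, rfl⟩ : ∃ e, d = e + 1 := ⟨d - 1, by omega⟩
  rw [Nat.add_sub_cancel]
  have h30 : (30 : ℝ) ^ (e + 1) = 15 ^ (e + 1) * (2 ^ e * 2) := by
    rw [← pow_succ, ← mul_pow]; norm_num
  have hP : (0 : ℝ) ≤ 15 ^ (e + 1) * 2 ^ e := by positivity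
  have lhs : (15 : ℝ) ^ (e + 1) * (3 * 2 ^ e * x + 2 ^ (e + 1)) = 15 ^ (e + 1) * 2 ^ e * (3 * x + 2) := by
    rw [pow_succ]; ring
  have rhs : (2 : ℝ) * 30 ^ (e + 1) * (x + 1 / 2) = 15 ^ (e + 1) * 2 ^ e * (4 * x + 2) := by
    rw [h30]; ring
  rw [lhs, rhs]
  exact mul_le_mul_of_nonneg_left (by linarith) hP

/-- The cube count of a seven-layer enlargement of one cube: `(2·7+1)^d = 15^d`, against `(2·3+1)^d = 7^d` for three
layers ([I] p. 257: *«□̃ⁿ as a cube of the size (1+2n)M»*). [cite: Balaban1989LargeFieldII, p.385 (the factor 7^d);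
Balaban1987RG1, p.257 (□̃ⁿ of size (1+2n)M)] -/
theorem cubes_of_seven_layers (d : ℕ) : (1 + 2 * 7) ^ d = 15 ^ d ∧ (1 + 2 * 3) ^ d = 7 ^ d := by
  constructor <;> norm_num

/-! ## §6 (v1.1, r13 gen 16, append-only) p. 386: «The property (1.76) implies (1.84)» — and p. 384's S over unions

B16 p. 386 [PDF 32], verbatim (text layer `p0032.txt` + render p032 read by r13 gens 9/15): *«In the second case Z is
obtained from some number of components of Z_j, and some number of new large field regions, joined together into the
one component of Z_{j+1} by the operations of the last step, in particular by adding layers of MR_{j+1}-cubes. Denote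
the components of Z_j by Z_j^{(n)}, and the new large field regions by Z_{j+1}^{(i)}. The property (1.76) implies
Z ⊂ ⋃_n (Z_j^{(n)})′^{~10} ∪ ⋃_i (Z_{j+1}^{(i)})^{~2}.  (1.84)»*; p. 384 [PDF 30]: *«S(Z) = Z′^{~10} … The domain Z is a
union of M₁ξ-cubes □, Z = ⋃_{□⊂Z} □, and by the definition of the operation S we have S^{n−j}(Z) = ⋃_{□⊂Z} S^{n−j}(□)»*;
p. 385 [PDF 31]: *«In the first case no large fields were introduced in the last step, hence Z = S(Z₀), where Z₀ is a
component of Z_j»*.  r11 g10 (B14 owner) CONFIRMED on the [III] renders (HOME/lit-balaban-r13/INBOX 2026-08-22T02:01Z)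
that every `~` of (3.2)–(3.5)/(3.16)/(3.20) is one layer of `LMR_{k+1}`-cubes of one partition and `Z = Λᶜ` — the
reading (a) of the module docstring.

WHAT §6 ADDS (set algebra on the same carrier; theorems only).  `S X := enl s 10 (enl s 0 X)` is not introduced as a
definition — it is written out.  **`S_eq_enl_ten`**: `enl s 10 (enl s 0 X) = enl s 10 X` (cover-then-ten-layers = ten
index layers).  **`S_iUnion`**: ONE application of S distributes over arbitrary unions (p. 384's sentence for n − j = 1;
the iterates S^{n−j} live on rescaled lattices — the cell's index model `B16SProfile.Siter` — and are not touched).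
**`incl184_of_incl176`**: over ABSTRACT enlargement maps exactly as the row's leaf `B16Sect1Kernels.Incl176` is typed —
(1.76) at step j+1 + `Z ⊆ Z_{j+1}` + `Z_j ⊆ ⋃_n Z_j^{(n)}` + distributivity/monotonicity of the `~10`-map ⇒ the
inclusion of (1.84), for ANY map in the new-region slot (so for the printed `~2` and for §2's `~6` alike).
**`incl184`**: the instance on this carrier (`enl s 10`, `enl s a`, any `a`).  **`incl184_six_of_construction`**: END TO
END from [III] (3.2)–(3.5)/(3.20) (§1's hypotheses `hB/hΩ/hΛ` + p. 380's `hcov`) with six layers in the new-region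
slot.  **`subset_iUnion_of_meets`**: the members of (1.84) may be restricted to the domains MEETING Z (p. 385/386 «It is
determined by some of the large field regions», «Z is obtained from some number of components … and some number of new
large field regions») — bookkeeping only.  **`largeField_next_eq_S_of_no_new`**: with no new large-field covers
(`P′ = Q′ = R′ = ∅`) the construction gives `Z_{k+1} = S(Z_k)` EXACTLY (p. 384 «Such a domain arises as a new large field
region in our procedure, if no large fields are created in a neighborhood of Z»; p. 385 first case) — at SET level; the
component statement «Z = S(Z₀)» additionally needs that no two old components merge under S, which is what puts merged
old components into p. 386's second case, and is not asserted here.  HONEST SCOPE as in the module docstring: rows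
B16.Eq1.84 (b02's `B16MergeGeometry`: touch graph, `Z ⊆ fam P S` as hypothesis) and B16.Eq1.83 keep their heads; this
section realizes the printed implication (1.76) ⇒ (1.84) and the S-bookkeeping by name, nothing more. -/

/-- **S written out: cover, then ten layers = ten index layers.**  `S(X) = X′^{~10}` with `X′ = enl s 0 X` equals
`enl s 10 X` on this carrier (`enl_enl`). [cite: Balaban1989LargeFieldII, p.384 (S(Z) = Z′^{~10})] -/
theorem S_eq_enl_ten (s : ℕ) (hs : 0 < s) (X : Set (Pt d)) : enl s 10 (enl s 0 X) = enl s 10 X :=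
  enl_enl_num s 0 10 10 hs rfl X

/-- **One application of S distributes over unions** (p. 384: *«Z = ⋃_{□⊂Z} □, and by the definition of the operation S
we have S^{n−j}(Z) = ⋃_{□⊂Z} S^{n−j}(□)»*, here for one step; any index family, not only cubes). [cite:
Balaban1989LargeFieldII, p.384 (S over unions)] -/
theorem S_iUnion {ι : Type*} (s : ℕ) (X : ι → Set (Pt d)) :
    enl s 10 (enl s 0 (⋃ m, X m)) = ⋃ m, enl s 10 (enl s 0 (X m)) := by
  rw [enl_iUnion, enl_iUnion]

/-- **«The property (1.76) implies (1.84)»** (p. 386), over ABSTRACT enlargement maps as the leaf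
`B16Sect1Kernels.Incl176` is typed: if `Z_{j+1} ⊆ enl10 Z_j ∪ ⋃_i enl2 (Z_{j+1}^{(i)})` ((1.76) at step j+1), `Z ⊆ Z_{j+1}`
(a component), `Z_j ⊆ ⋃_n Z_j^{(n)}` (its components) and `enl10` is monotone and distributes over that union, then
`Z ⊆ ⋃_n enl10 (Z_j^{(n)}) ∪ ⋃_i enl2 (Z_{j+1}^{(i)})` — (1.84), for ANY map `enl2` in the new-region slot. [cite:
Balaban1989LargeFieldII, (1.84) p.386, (1.76) p.381] -/
theorem incl184_of_incl176 {α ι κ : Type*} (enl10 enl2 : Set α → Set α) (Zprev : Set α) (Zcomp : κ → Set α)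
    (Znew : ι → Set α) (Zj Z : Set α) (h176 : B16Sect1Kernels.Incl176 enl10 enl2 Zprev Znew Zj) (hZ : Z ⊆ Zj)
    (hcomp : Zprev ⊆ ⋃ n, Zcomp n) (hmono : ∀ X Y : Set α, X ⊆ Y → enl10 X ⊆ enl10 Y)
    (hdist : enl10 (⋃ n, Zcomp n) ⊆ ⋃ n, enl10 (Zcomp n)) :
    Z ⊆ (⋃ n, enl10 (Zcomp n)) ∪ ⋃ i, enl2 (Znew i) := by
  intro x hx
  rcases h176 (hZ hx) with h | h
  · exact Or.inl (hdist (hmono _ _ hcomp h))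
  · exact Or.inr h

/-- **(1.84) on the cube-layer carrier**, any layer count `a` in the new-region slot (`a = 2` as printed, `a = 6` in §2's
reading): from `Incl176 (enl s 10) (enl s a) (enl s 0 Z_j) Znew Z_{j+1}`, `Z ⊆ Z_{j+1}` and `Z_j ⊆ ⋃_n Z_j^{(n)}`:
`Z ⊆ ⋃_n S(Z_j^{(n)}) ∪ ⋃_i (Z_{j+1}^{(i)})^{~a}` with `S(X) = enl s 10 (enl s 0 X)`. [cite: Balaban1989LargeFieldII, (1.84)
p.386, (1.76) p.381, p.384 (S)] -/
theorem incl184 {ι κ : Type*} (s a : ℕ) (Zj Zj1 Z : Set (Pt d)) (Zcomp : κ → Set (Pt d)) (Znew : ι → Set (Pt d))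
    (h176 : B16Sect1Kernels.Incl176 (enl s 10) (enl s a) (enl s 0 Zj) Znew Zj1) (hZ : Z ⊆ Zj1)
    (hcomp : Zj ⊆ ⋃ n, Zcomp n) :
    Z ⊆ (⋃ n, enl s 10 (enl s 0 (Zcomp n))) ∪ ⋃ i, enl s a (Znew i) := by
  have h176' : B16Sect1Kernels.Incl176 (fun X => enl s 10 (enl s 0 X)) (enl s a) Zj Znew Zj1 := h176
  exact incl184_of_incl176 (fun X => enl s 10 (enl s 0 X)) (enl s a) Zj Zcomp Znew Zj1 Z h176' hZ hcomp
    (fun X Y hXY => enl_mono s 10 (enl_mono s 0 hXY)) (S_iUnion s Zcomp).le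

/-- **(1.84) END TO END from the [III] §3 construction, six layers in the new-region slot.**  Under §1's transcription
(`hB`, `hΩ`, `hΛ`) of (3.2)–(3.5)/(3.20), p. 380's cover sentence `hcov : P′ ∪ Q′ ∪ R′ ⊆ ⋃_i Z_{j+1}^{(i)}` and
`Z_j ⊆ ⋃_n Z_j^{(n)}`, every `Z ⊆ Z_{j+1} = Λ_{j+1}ᶜ` satisfies `Z ⊆ ⋃_n S(Z_j^{(n)}) ∪ ⋃_i (Z_{j+1}^{(i)})^{~6}`
(`incl176_six_components` ∘ `incl184`). [cite: Balaban1989LargeFieldII, (1.84) p.386, (1.76) p.381, p.380, p.384;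
Balaban1988Convergent, (3.5) p.265, (3.20) p.269] -/
theorem incl184_six_of_construction {ι κ : Type*} (s : ℕ) (hs : 0 < s) (Zk P' Q' R' B Ω Λ₁ Z : Set (Pt d))
    (Zcomp : κ → Set (Pt d)) (Znew : ι → Set (Pt d)) (hcov : P' ∪ Q' ∪ R' ⊆ ⋃ i, Znew i)
    (hcomp : Zk ⊆ ⋃ n, Zcomp n)
    (hB : B = (enl s 1 P')ᶜ ∩ (enl s 5 (enl s 0 Zk))ᶜ)
    (hΩ : Ω = (enl s 2 Q' ∪ enl s 3 Bᶜ)ᶜ)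
    (hΛ : Λ₁ = (enl s 2 Ωᶜ ∪ enl s 1 R')ᶜ) (hZ : Z ⊆ Λ₁ᶜ) :
    Z ⊆ (⋃ n, enl s 10 (enl s 0 (Zcomp n))) ∪ ⋃ i, enl s 6 (Znew i) :=
  incl184 s 6 Zk Λ₁ᶜ Z Zcomp Znew (incl176_six_components s hs Zk P' Q' R' B Ω Λ₁ Znew hcov hB hΩ hΛ) hZ hcomp

/-- **The members of (1.84) may be restricted to the domains meeting Z** (p. 385: *«It is determined by some of the large
field regions Z₁^{(i)}»*; p. 386: *«Z is obtained from some number of components of Z_j, and some number of new large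
field regions»*): if `Z ⊆ ⋃_m A_m` then `Z ⊆ ⋃ {A_m : A_m ∩ Z ≠ ∅}`. Bookkeeping. [cite: Balaban1989LargeFieldII, p.385–386
(the determining domains of (1.84))] -/
theorem subset_iUnion_of_meets {α μ : Type*} (Z : Set α) (A : μ → Set α) (h : Z ⊆ ⋃ m, A m) :
    Z ⊆ ⋃ m ∈ {m | (A m ∩ Z).Nonempty}, A m := by
  intro x hx
  obtain ⟨m, hm⟩ := Set.mem_iUnion.1 (h hx)
  exact Set.mem_biUnion (show m ∈ {m | (A m ∩ Z).Nonempty} from ⟨x, hm, hx⟩) hm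

/-- **First case of p. 385 at set level: no new large-field covers ⇒ `Z_{k+1} = S(Z_k)`.**  With `P′ = Q′ = R′ = ∅` the
construction (3.2)–(3.5)/(3.20) returns exactly `Λ_{k+1}ᶜ = enl s 10 (enl s 0 Z_k) = S(Z_k)` (p. 384: *«Such a domain
arises as a new large field region in our procedure, if no large fields are created in a neighborhood of Z»*; p. 385:
*«In the first case no large fields were introduced in the last step, hence Z = S(Z₀)»* — the component form needs in
addition that old components do not merge under S, cf. the second case, and is not asserted). [cite:
Balaban1989LargeFieldII, p.384 (S(Z)), p.385 (first case, Z = S(Z₀)); Balaban1988Convergent, (3.5) p.265, (3.20) p.269] -/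
theorem largeField_next_eq_S_of_no_new (s : ℕ) (hs : 0 < s) (Zk B Ω Λ₁ : Set (Pt d))
    (hB : B = (enl s 1 (∅ : Set (Pt d)))ᶜ ∩ (enl s 5 (enl s 0 Zk))ᶜ)
    (hΩ : Ω = (enl s 2 (∅ : Set (Pt d)) ∪ enl s 3 Bᶜ)ᶜ)
    (hΛ : Λ₁ = (enl s 2 Ωᶜ ∪ enl s 1 (∅ : Set (Pt d)))ᶜ) :
    Λ₁ᶜ = enl s 10 (enl s 0 Zk) := by
  rw [largeField_next_eq s hs Zk ∅ ∅ ∅ B Ω Λ₁ hB hΩ hΛ, enl_empty, enl_empty, enl_empty]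
  simp

end Literature.MathematicalPhysics.QuantumFieldTheory.Balaban1983to89.B16Incl176Layers
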